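import Summits.MatrixMultiplication.OmegaCensus.GoldenUniformAll
import Summits.MatrixMultiplication.OmegaCensus.GoldenSmall
import Summits.MatrixMultiplication.OmegaCensus.GoldenFlip
import Summits.MatrixMultiplication.OmegaCensus.GoldenCerts1
import Summits.MatrixMultiplication.OmegaCensus.GoldenCerts2
import Summits.MatrixMultiplication.OmegaCensus.GoldenCerts3
import Summits.MatrixMultiplication.OmegaCensus.GoldenCerts4
import Summits.MatrixMultiplication.OmegaCensus.GoldenCerts5

/-!
# ω-census, family (b3): conjecture C9 — the golden groups `𝔽_p[ζ₅] ⋊ C₅` are not box-useful for EVERY prime `p` and every root `τ`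

HONEST FRAMING (pub-omega census; verbatim): lottery ticket; floor = certified bounds/negative ranges.
Census BOOKKEEPING (conjecture C9 of the cell; pub-omega stpp-1 gen 22).  ASSEMBLY: `GoldCyc.not_boxUseful_ge` (`p ≥ 400`,
`GoldenUniformAll`) + the per-prime certificates `gold_p` for the 35 primes `p < 400` having a root of `x² + x = 1`
(`GoldenCerts1–5`; `p = 5, 11` by explicit patterns, `GoldenSmall`) transported to the other root by `GoldCyc.not_boxUseful_of_root`
(`GoldenFlip`) + `noroot_q` (`decide`) for the 43 primes `q < 400` without a root, over the complete list of primes below `400`.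
**`GoldCyc.not_boxUseful`: for every prime `p` and every `τ ∈ 𝔽_p` with `τ² + τ = 1`, `𝔽_p[ζ] ⋊_ζ ℤ/5 = GoldCyc p τ` (order `5p²`)
is not box-useful** — box ratio `≥ 9/5` on the whole family.  For `p ≡ 4 (mod 5)` these are the Schmidt atoms `A(p,5) = 𝔽_{p²} ⋊ C₅`
(minimal non-nilpotent groups, `k = ord₅ p = 2`; orders `1805, 4205, 17405, …`), for `p ≡ 1 (mod 5)` the Frobenius groups
`C_p² ⋊ C₅`, for `p = 5` the extraspecial group `5^{1+2}_+`: C9 (b) (trivial centre / `[G:Z] = 25` ⇒ not useful) confirmed on all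
of them (note HOME/pub-omega-stpp-1-g21/ATOMS-NONNILPOTENT-C9.md: with `A(p,2)`, `A(p,3)` (`FrobeniusAll`, `EisClassTable`), `A(2,5)`,
`A(3,5)` (`SchmidtAtomsQ5`) every Schmidt atom `A(p,q)` with `q ≤ 3`, or `q = 5` and `k ≤ 2`, is now kernel-certified not box-useful).
Nothing here is progress on `ω`.
-/

namespace Summit.MatrixMultiplication.OmegaCensus

namespace GoldArcs

/-! ### Primes below `400` without a root of `x² + x = 1` (`p = 2, 3` and `p ≡ ±2 (mod 5)`) -/

/-- `x² + x = 1` has no root modulo `2`. [folklore] -/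
theorem noroot_2 : ∀ σ : ZMod 2, σ ^ 2 + σ ≠ 1 := by decide +kernel

/-- `x² + x = 1` has no root modulo `3`. [folklore] -/
theorem noroot_3 : ∀ σ : ZMod 3, σ ^ 2 + σ ≠ 1 := by decide +kernel

/-- `x² + x = 1` has no root modulo `7`. [folklore] -/
theorem noroot_7 : ∀ σ : ZMod 7, σ ^ 2 + σ ≠ 1 := by decide +kernel

/-- `x² + x = 1` has no root modulo `13`. [folklore] -/
theorem noroot_13 : ∀ σ : ZMod 13, σ ^ 2 + σ ≠ 1 := by decide +kernel

/-- `x² + x = 1` has no root modulo `17`. [folklore] -/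
theorem noroot_17 : ∀ σ : ZMod 17, σ ^ 2 + σ ≠ 1 := by decide +kernel

/-- `x² + x = 1` has no root modulo `23`. [folklore] -/
theorem noroot_23 : ∀ σ : ZMod 23, σ ^ 2 + σ ≠ 1 := by decide +kernel

/-- `x² + x = 1` has no root modulo `37`. [folklore] -/
theorem noroot_37 : ∀ σ : ZMod 37, σ ^ 2 + σ ≠ 1 := by decide +kernel

/-- `x² + x = 1` has no root modulo `43`. [folklore] -/
theorem noroot_43 : ∀ σ : ZMod 43, σ ^ 2 + σ ≠ 1 := by decide +kernel

/-- `x² + x = 1` has no root modulo `47`. [folklore] -/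
theorem noroot_47 : ∀ σ : ZMod 47, σ ^ 2 + σ ≠ 1 := by decide +kernel

/-- `x² + x = 1` has no root modulo `53`. [folklore] -/
theorem noroot_53 : ∀ σ : ZMod 53, σ ^ 2 + σ ≠ 1 := by decide +kernel

/-- `x² + x = 1` has no root modulo `67`. [folklore] -/
theorem noroot_67 : ∀ σ : ZMod 67, σ ^ 2 + σ ≠ 1 := by decide +kernel

/-- `x² + x = 1` has no root modulo `73`. [folklore] -/
theorem noroot_73 : ∀ σ : ZMod 73, σ ^ 2 + σ ≠ 1 := by decide +kernel

/-- `x² + x = 1` has no root modulo `83`. [folklore] -/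
theorem noroot_83 : ∀ σ : ZMod 83, σ ^ 2 + σ ≠ 1 := by decide +kernel

/-- `x² + x = 1` has no root modulo `97`. [folklore] -/
theorem noroot_97 : ∀ σ : ZMod 97, σ ^ 2 + σ ≠ 1 := by decide +kernel

/-- `x² + x = 1` has no root modulo `103`. [folklore] -/
theorem noroot_103 : ∀ σ : ZMod 103, σ ^ 2 + σ ≠ 1 := by decide +kernel

/-- `x² + x = 1` has no root modulo `107`. [folklore] -/
theorem noroot_107 : ∀ σ : ZMod 107, σ ^ 2 + σ ≠ 1 := by decide +kernel

/-- `x² + x = 1` has no root modulo `113`. [folklore] -/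
theorem noroot_113 : ∀ σ : ZMod 113, σ ^ 2 + σ ≠ 1 := by decide +kernel

/-- `x² + x = 1` has no root modulo `127`. [folklore] -/
theorem noroot_127 : ∀ σ : ZMod 127, σ ^ 2 + σ ≠ 1 := by decide +kernel

/-- `x² + x = 1` has no root modulo `137`. [folklore] -/
theorem noroot_137 : ∀ σ : ZMod 137, σ ^ 2 + σ ≠ 1 := by decide +kernel

/-- `x² + x = 1` has no root modulo `157`. [folklore] -/
theorem noroot_157 : ∀ σ : ZMod 157, σ ^ 2 + σ ≠ 1 := by decide +kernel

/-- `x² + x = 1` has no root modulo `163`. [folklore] -/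
theorem noroot_163 : ∀ σ : ZMod 163, σ ^ 2 + σ ≠ 1 := by decide +kernel

/-- `x² + x = 1` has no root modulo `167`. [folklore] -/
theorem noroot_167 : ∀ σ : ZMod 167, σ ^ 2 + σ ≠ 1 := by decide +kernel

/-- `x² + x = 1` has no root modulo `173`. [folklore] -/
theorem noroot_173 : ∀ σ : ZMod 173, σ ^ 2 + σ ≠ 1 := by decide +kernel

/-- `x² + x = 1` has no root modulo `193`. [folklore] -/
theorem noroot_193 : ∀ σ : ZMod 193, σ ^ 2 + σ ≠ 1 := by decide +kernel

/-- `x² + x = 1` has no root modulo `197`. [folklore] -/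
theorem noroot_197 : ∀ σ : ZMod 197, σ ^ 2 + σ ≠ 1 := by decide +kernel

/-- `x² + x = 1` has no root modulo `223`. [folklore] -/
theorem noroot_223 : ∀ σ : ZMod 223, σ ^ 2 + σ ≠ 1 := by decide +kernel

/-- `x² + x = 1` has no root modulo `227`. [folklore] -/
theorem noroot_227 : ∀ σ : ZMod 227, σ ^ 2 + σ ≠ 1 := by decide +kernel

/-- `x² + x = 1` has no root modulo `233`. [folklore] -/
theorem noroot_233 : ∀ σ : ZMod 233, σ ^ 2 + σ ≠ 1 := by decide +kernel

/-- `x² + x = 1` has no root modulo `257`. [folklore] -/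
theorem noroot_257 : ∀ σ : ZMod 257, σ ^ 2 + σ ≠ 1 := by decide +kernel

/-- `x² + x = 1` has no root modulo `263`. [folklore] -/
theorem noroot_263 : ∀ σ : ZMod 263, σ ^ 2 + σ ≠ 1 := by decide +kernel

/-- `x² + x = 1` has no root modulo `277`. [folklore] -/
theorem noroot_277 : ∀ σ : ZMod 277, σ ^ 2 + σ ≠ 1 := by decide +kernel

/-- `x² + x = 1` has no root modulo `283`. [folklore] -/
theorem noroot_283 : ∀ σ : ZMod 283, σ ^ 2 + σ ≠ 1 := by decide +kernel

/-- `x² + x = 1` has no root modulo `293`. [folklore] -/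
theorem noroot_293 : ∀ σ : ZMod 293, σ ^ 2 + σ ≠ 1 := by decide +kernel

/-- `x² + x = 1` has no root modulo `307`. [folklore] -/
theorem noroot_307 : ∀ σ : ZMod 307, σ ^ 2 + σ ≠ 1 := by decide +kernel

/-- `x² + x = 1` has no root modulo `313`. [folklore] -/
theorem noroot_313 : ∀ σ : ZMod 313, σ ^ 2 + σ ≠ 1 := by decide +kernel

/-- `x² + x = 1` has no root modulo `317`. [folklore] -/
theorem noroot_317 : ∀ σ : ZMod 317, σ ^ 2 + σ ≠ 1 := by decide +kernel

/-- `x² + x = 1` has no root modulo `337`. [folklore] -/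
theorem noroot_337 : ∀ σ : ZMod 337, σ ^ 2 + σ ≠ 1 := by decide +kernel

/-- `x² + x = 1` has no root modulo `347`. [folklore] -/
theorem noroot_347 : ∀ σ : ZMod 347, σ ^ 2 + σ ≠ 1 := by decide +kernel

/-- `x² + x = 1` has no root modulo `353`. [folklore] -/
theorem noroot_353 : ∀ σ : ZMod 353, σ ^ 2 + σ ≠ 1 := by decide +kernel

/-- `x² + x = 1` has no root modulo `367`. [folklore] -/
theorem noroot_367 : ∀ σ : ZMod 367, σ ^ 2 + σ ≠ 1 := by decide +kernel

/-- `x² + x = 1` has no root modulo `373`. [folklore] -/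
theorem noroot_373 : ∀ σ : ZMod 373, σ ^ 2 + σ ≠ 1 := by decide +kernel

/-- `x² + x = 1` has no root modulo `383`. [folklore] -/
theorem noroot_383 : ∀ σ : ZMod 383, σ ^ 2 + σ ≠ 1 := by decide +kernel

/-- `x² + x = 1` has no root modulo `397`. [folklore] -/
theorem noroot_397 : ∀ σ : ZMod 397, σ ^ 2 + σ ≠ 1 := by decide +kernel

/-- The primes below `400`. [folklore] -/
def primes400 : List ℕ :=
  [2, 3, 5, 7, 11, 13, 17, 19, 23, 29, 31, 37, 41, 43, 47, 53, 59, 61, 67, 71, 73, 79, 83, 89, 97, 101, 103, 107, 109, 113,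
   127, 131, 137, 139, 149, 151, 157, 163, 167, 173, 179, 181, 191, 193, 197, 199, 211, 223, 227, 229, 233, 239, 241, 251,
   257, 263, 269, 271, 277, 281, 283, 293, 307, 311, 313, 317, 331, 337, 347, 349, 353, 359, 367, 373, 379, 383, 389, 397]

/-- Completeness of the list (by `decide`). [folklore] -/
theorem primes400_complete : ∀ q, q < 400 → Nat.Prime q → q ∈ primes400 := by
  decide +kernel

end GoldArcs

namespace GoldCyc

open GoldArcs

/-- **THEOREM (golden family, ALL primes, all roots).** For every prime `p` and every `τ ∈ 𝔽_p` with `τ² + τ = 1`, the golden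
group `𝔽_p[ζ] ⋊_ζ ℤ/5 = GoldCyc p τ` is not box-useful. [folklore] -/
theorem not_boxUseful {p : ℕ} [Fact p.Prime] {τ : ZMod p} [hτ : Fact (τ ^ 2 + τ = 1)] : ¬ BoxUseful (GoldCyc p τ) := by
  by_cases h400 : 400 ≤ p
  · exact not_boxUseful_ge h400
  · have hmem := primes400_complete p (by omega) Fact.out
    simp only [primes400, List.mem_cons, List.not_mem_nil, or_false] at hmem
    rcases hmem with rfl | rfl | rfl | rfl | rfl | rfl | rfl | rfl | rfl | rfl | rfl | rfl | rfl | rfl | rfl | rfl | rfl | rfl | rfl | rfl | rfl | rfl | rfl | rfl | rfl | rfl | rfl | rfl | rfl | rfl | rfl | rfl | rfl | rfl | rfl | rfl | rfl | rfl | rfl | rfl | rfl | rfl | rfl | rfl | rfl | rfl | rfl | rfl | rfl | rfl | rfl | rfl | rfl | rfl | rfl | rfl | rfl | rfl | rfl | rfl | rfl | rfl | rfl | rfl | rfl | rfl | rfl | rfl | rfl | rfl | rfl | rfl | rfl | rfl | rfl | rfl | rfl | rfl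
    · exact absurd hτ.out (noroot_2 τ)
    · exact absurd hτ.out (noroot_3 τ)
    · exact not_boxUseful_of_root GoldSmall.gold_5 τ
    · exact absurd hτ.out (noroot_7 τ)
    · exact not_boxUseful_of_root GoldSmall.gold_11 τ
    · exact absurd hτ.out (noroot_13 τ)
    · exact absurd hτ.out (noroot_17 τ)
    · exact not_boxUseful_of_root GoldArcs.gold_19 τ
    · exact absurd hτ.out (noroot_23 τ)
    · exact not_boxUseful_of_root GoldArcs.gold_29 τ
    · exact not_boxUseful_of_root GoldArcs.gold_31 τ
    · exact absurd hτ.out (noroot_37 τ)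
    · exact not_boxUseful_of_root GoldArcs.gold_41 τ
    · exact absurd hτ.out (noroot_43 τ)
    · exact absurd hτ.out (noroot_47 τ)
    · exact absurd hτ.out (noroot_53 τ)
    · exact not_boxUseful_of_root GoldArcs.gold_59 τ
    · exact not_boxUseful_of_root GoldArcs.gold_61 τ
    · exact absurd hτ.out (noroot_67 τ)
    · exact not_boxUseful_of_root GoldArcs.gold_71 τ
    · exact absurd hτ.out (noroot_73 τ)
    · exact not_boxUseful_of_root GoldArcs.gold_79 τ
    · exact absurd hτ.out (noroot_83 τ)
    · exact not_boxUseful_of_root GoldArcs.gold_89 τ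
    · exact absurd hτ.out (noroot_97 τ)
    · exact not_boxUseful_of_root GoldArcs.gold_101 τ
    · exact absurd hτ.out (noroot_103 τ)
    · exact absurd hτ.out (noroot_107 τ)
    · exact not_boxUseful_of_root GoldArcs.gold_109 τ
    · exact absurd hτ.out (noroot_113 τ)
    · exact absurd hτ.out (noroot_127 τ)
    · exact not_boxUseful_of_root GoldArcs.gold_131 τ
    · exact absurd hτ.out (noroot_137 τ)
    · exact not_boxUseful_of_root GoldArcs.gold_139 τ
    · exact not_boxUseful_of_root GoldArcs.gold_149 τ
    · exact not_boxUseful_of_root GoldArcs.gold_151 τ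
    · exact absurd hτ.out (noroot_157 τ)
    · exact absurd hτ.out (noroot_163 τ)
    · exact absurd hτ.out (noroot_167 τ)
    · exact absurd hτ.out (noroot_173 τ)
    · exact not_boxUseful_of_root GoldArcs.gold_179 τ
    · exact not_boxUseful_of_root GoldArcs.gold_181 τ
    · exact not_boxUseful_of_root GoldArcs.gold_191 τ
    · exact absurd hτ.out (noroot_193 τ)
    · exact absurd hτ.out (noroot_197 τ)
    · exact not_boxUseful_of_root GoldArcs.gold_199 τ
    · exact not_boxUseful_of_root GoldArcs.gold_211 τ
    · exact absurd hτ.out (noroot_223 τ)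
    · exact absurd hτ.out (noroot_227 τ)
    · exact not_boxUseful_of_root GoldArcs.gold_229 τ
    · exact absurd hτ.out (noroot_233 τ)
    · exact not_boxUseful_of_root GoldArcs.gold_239 τ
    · exact not_boxUseful_of_root GoldArcs.gold_241 τ
    · exact not_boxUseful_of_root GoldArcs.gold_251 τ
    · exact absurd hτ.out (noroot_257 τ)
    · exact absurd hτ.out (noroot_263 τ)
    · exact not_boxUseful_of_root GoldArcs.gold_269 τ
    · exact not_boxUseful_of_root GoldArcs.gold_271 τ
    · exact absurd hτ.out (noroot_277 τ)
    · exact not_boxUseful_of_root GoldArcs.gold_281 τ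
    · exact absurd hτ.out (noroot_283 τ)
    · exact absurd hτ.out (noroot_293 τ)
    · exact absurd hτ.out (noroot_307 τ)
    · exact not_boxUseful_of_root GoldArcs.gold_311 τ
    · exact absurd hτ.out (noroot_313 τ)
    · exact absurd hτ.out (noroot_317 τ)
    · exact not_boxUseful_of_root GoldArcs.gold_331 τ
    · exact absurd hτ.out (noroot_337 τ)
    · exact absurd hτ.out (noroot_347 τ)
    · exact not_boxUseful_of_root GoldArcs.gold_349 τ
    · exact absurd hτ.out (noroot_353 τ)
    · exact not_boxUseful_of_root GoldArcs.gold_359 τ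
    · exact absurd hτ.out (noroot_367 τ)
    · exact absurd hτ.out (noroot_373 τ)
    · exact not_boxUseful_of_root GoldArcs.gold_379 τ
    · exact absurd hτ.out (noroot_383 τ)
    · exact not_boxUseful_of_root GoldArcs.gold_389 τ
    · exact absurd hτ.out (noroot_397 τ)

/-- The `p`-only form: for every prime `p ≡ ±1 (mod 5)` or `p = 5` … — rather: whenever `𝔽_p` contains a root `τ` of `x² + x = 1`,
the group `GoldCyc p τ` of order `5p²` is not box-useful (restatement with the root as a hypothesis). [folklore] -/
theorem not_boxUseful' {p : ℕ} [Fact p.Prime] (τ : ZMod p) (hτ : τ ^ 2 + τ = 1) :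
    haveI : Fact (τ ^ 2 + τ = 1) := ⟨hτ⟩
    ¬ BoxUseful (GoldCyc p τ) := by
  haveI : Fact (τ ^ 2 + τ = 1) := ⟨hτ⟩
  exact not_boxUseful

end GoldCyc

end Summit.MatrixMultiplication.OmegaCensus
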